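import Mathlib
import Literature.Analysis.FluidPDE.Tao2016AveragedNS.ShiftSetCascadeFlows
import Literature.Analysis.FluidPDE.Tao2016AveragedNS.ShiftSetCascadeFlux
import Summits.NavierStokesRegularity.NavierStokesRegularity.Theorems.TaoLadderRungTwoFlatGappedFrontRobustPhantomFrontOn
import Summits.NavierStokesRegularity.NavierStokesRegularity.Theorems.TaoLadderRungThreeGappedFrontRobustStepTransfer
import Summits.NavierStokesRegularity.NavierStokesRegularity.Theorems.TaoLadderRungTwoFlatGappedFrontRobustV2ClosenessOn
import Summits.NavierStokesRegularity.NavierStokesRegularity.Theorems.TaoLadderRungTwoFlatRestartControlOn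
import Summits.NavierStokesRegularity.NavierStokesRegularity.Theorems.TaoLadderRungTwoFlatLocalDynamicsSufficesAtOn
import Summits.NavierStokesRegularity.NavierStokesRegularity.Theorems.TaoLadderRungThreeRestartGlue
import Summits.NavierStokesRegularity.NavierStokesRegularity.Theorems.TaoLadderRungTwoFlatGappedFrontRobustV2Flat
import HarnessLib

/-!
# A fixed-`ε₀` certificate in format A♭ gives Theorem-4.2-level blow-up AT THAT `ε₀`, on any admissible
  shift set (helper for item stmt-NavierStokesRegularity-22987 `FlatGapCertificatesV2`, crux K_A♭ of route
  TaoLadderRungTwoFlat; cell harvest/h2-tao-ladder, p1 g13)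

The route `TaoLadderRungTwoFlat` closes its `∀ε₀`-leaf from the FIVE items K_A♭ → K_B♭ → RestartControlOn →
RestartGlue → LocalDynamicsSufficesAtOn. Four of the five are PROVED (p1 g12: K_B♭ =
`GappedFrontRobustOn.gappedFrontRobustV2On_closeness` for a general nearest-neighbour slot-closed shift set
`𝕊 ∌ (1,1,1)`; typer: `RestartControlOn.main`, `LocalDynamicsSufficesAtOn.noGlobalCascadeOn_of_local`;
`RestartGlue.epochCheckpoints_succ`), all table-generic. This file runs that chain POINTWISE IN `ε₀` and FOR
THE CERTIFIED TABLE ITSELF: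

**`noGlobalCascadeOn_of_gapData₂On`.** For every nearest-neighbour slot-closed shift set `𝕊` with
`(1,1,1) ∉ 𝕊` (Tao's `S`, the two-way `S♭`, …), every number of modes `m`, every `R`-comparable symmetric
cancelling table `α` supported on `𝕊`, every `ε₀ > 0` and every one-shell datum `X₀` with `X₀ i₀ ≠ 0`:
format-v2 gap data ON `𝕊` at scale ratio `1+ε₀` with a thin tail,
`GapData₂On 𝕊 σ ε₀ i₀ α X₀ Z w r ρ θ₀ θ c₀ c env₀ ∧ TailThin ε₀ w r`, imply `NoGlobalCascadeOn 𝕊 ε₀ α X₀`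
— no global `(K₁,K₂)`-pseudo-solution of the `𝕊`-lattice from the datum for any defect budget, from all
large starting shells. Corollaries `noGlobalCascadeOn_flat_of_gapData₂On` (`𝕊 = S♭`) and
`noGlobalCascade_of_gapData₂` (`𝕊 = S`, the tree's `GapData₂`/`NoGlobalCascade`).

USE. A fixed-`ε₀` certificate — e.g. the registered stub `stub_rung_quarter` of K_A♭ (the mirror-seeded
Toda table `T♭(1/2)` on `S♭` at `ε₀ = 1/4`), or a K_A₂(64) certificate at `ε₀ = 1` on `S` — is thereby a
blow-up theorem for THAT table at THAT scale ratio, with no further route bookkeeping («frontier rungs»,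
theory-1 T-29 / referee R2). Also recorded: `robustStepOn_of_gapData₂On` (K_B♭ packaged as
`FrontExistsOn ∧ RobustStepOn` for general `𝕊`) and `dynamicsLocal_of_robustStepOn` (the checkpoint
induction step from a robust front step, general `𝕊`).

HONEST FRAMING: statements about Tao-type MODEL lattices (Tao 2016 §4/§6 vocabulary, shift-set
parametrised); nothing here is a statement about the Navier–Stokes equations, no certificate is produced,
and nothing is claimed for all small `ε₀`.
-/

noncomputable section

-- the sub-problem namespace repeats the summit name by design (D-0017)
set_option linter.dupNamespace false

namespace Summit.NavierStokesRegularity.NavierStokesRegularity.Theorems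

open Set Literature.Analysis.FluidPDE Literature.Analysis.FluidPDE.TaoCascade
open Summit.NavierStokesRegularity.NavierStokesRegularity.Theorems.GappedFrontRobustOn

namespace CertificateGlueOn

variable {m : ℕ} {𝕊 : Finset (ℤ × ℤ × ℤ)}

/-- **K_B on `𝕊`, packaged**: format-v2 gap data on an admissible shift set with a thin tail give a margin
`η > 0` and an epoch envelope `env` with BOTH clauses of a robust front step for the ball description
(`FrontExistsOn` and `RobustStepOn`) — p1 g12's three-zone theorem `gappedFrontRobustV2On_closeness`
composed with `frontExistsOn_of_gapDataOn` and `stepTo_transfer`, exactly as in the K_B♭ closing file but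
for general `𝕊`. [cite: Tao2016AveragedNS, §6.3–6.4 Props. 6.4–6.5 (statement shape); §4 Lemma 4.1 (4.5), (4.8)–(4.10)] -/
theorem robustStepOn_of_gapData₂On (h𝕊 : IsNearestNeighbourSet 𝕊) (h𝕊c : IsSlotClosed 𝕊)
    (h111 : ((1 : ℤ), (1 : ℤ), (1 : ℤ)) ∉ 𝕊) {R σ ε₀ : ℝ} {i₀ : Fin m}
    {α : Fin m → Fin m → Fin m → ℤ × ℤ × ℤ → ℝ} {X₀ : Fin m → ℝ} {Z : Set (Fin m → ℤ → ℝ)}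
    {w : ℤ → ℝ} {r ρ θ₀ θ c₀ c : ℝ} {env₀ : ℤ → ℝ} (hα : InTableClassOn 𝕊 R α) (hε : 0 < ε₀)
    (hgap : GapData₂On 𝕊 σ ε₀ i₀ α X₀ Z w r ρ θ₀ θ c₀ c env₀) (hthin : TailThin ε₀ w r) :
    ∃ (η : ℝ) (env : ℤ → ℝ), 0 < η ∧ FrontExistsOn 𝕊 ε₀ θ c η α (ballDesc Z w r) env ∧
      RobustStepOn 𝕊 ε₀ θ c η i₀ α (ballDesc Z w r) env := by
  obtain ⟨η, hη, env, hdec, hclose⟩ :=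
    gappedFrontRobustV2On_closeness h𝕊 h𝕊c h111 R σ ε₀ i₀ α X₀ Z w r ρ θ₀ θ c₀ c env₀ hα hε hgap hthin
  have hgap1 : GapDataOn 𝕊 ε₀ i₀ α X₀ Z w r ρ θ₀ θ c₀ c env₀ := hgap.1
  refine ⟨η, env, hη, frontExistsOn_of_gapDataOn hε hgap1 hη hdec, ?_⟩
  intro L S₀ F₀ B₀ hball hB τ hτc S' F' hflow'
  obtain ⟨hr, hρ0, hρ1, hθ₀, hθ₀θ, hθ, hc₀, hc₀c, hw1, -, -, hex, -⟩ := hgap1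
  obtain ⟨hσ, -, hslack, -⟩ := hgap.2
  obtain ⟨z, hz, hzr⟩ := hball
  obtain ⟨S, F, hSF⟩ := hex S₀ ⟨z, hz, hzr⟩
  obtain ⟨τ₁, a, hstep, hmargin⟩ := hslack S₀ c S F ⟨z, hz, hzr⟩ hc₀c.le hSF
  obtain ⟨hfront, hballc, henv⟩ :=
    hclose L S₀ F₀ B₀ ⟨z, hz, hzr⟩ hB τ hτc S' F' hflow' S F hSF τ₁ a hstep hmargin
  exact ⟨τ₁, a, GappedFrontRobust.stepTo_transfer hε.le hθ₀θ.le hc₀c.le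
    (fun k => (zero_le_one.trans (hw1 k))) hstep (by linarith) hfront hballc henv⟩

/-- **The local checkpoint induction from a robust front step, on `𝕊`**: with `RobustStepOn` for a
description `P` (margin `η > 0`, clock `c > 0`, `θ ≤ 1/2`) and a charged datum, for all implied constants
`K₁, K₂ ≥ 0` and all large `n₀`, along every local `𝕊`-pseudo-solution on `[0,T]`, epoch checkpoints whose
next lifespan fits inside `[0,T]` extend by one level — restart at the checkpoint (`RestartControlOn.main`,
scale covariance with defects `O((1+ε₀)^{-n₀/2})`), step the restarted flow (`RobustStepOn`), re-glue
(`RestartGlue.epochCheckpoints_succ`). [cite: Tao2016AveragedNS, §6.4 Prop. 6.5 ⇒ §6.2 Prop. 6.3 (the inductive step)] -/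
theorem dynamicsLocal_of_robustStepOn {ε₀ θ c η : ℝ} {i₀ : Fin m}
    {α : Fin m → Fin m → Fin m → ℤ × ℤ × ℤ → ℝ} {X₀ : Fin m → ℝ}
    {P : (Fin m → ℤ → ℝ) → (Fin m → ℤ → ℝ) → Prop} {env : ℤ → ℝ}
    (hε : 0 < ε₀) (hθ : θ ≤ 1 / 2) (hc : 0 < c) (hη : 0 < η) (hX₀ : X₀ i₀ ≠ 0)
    (hstep : RobustStepOn 𝕊 ε₀ θ c η i₀ α P env) :
    ∀ K₁ K₂ : ℝ, 0 ≤ K₁ → 0 ≤ K₂ → ∃ N₀ : ℤ, ∀ n₀ : ℤ, N₀ ≤ n₀ →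
      ∀ T : ℝ, 0 < T → ∀ X E : Fin m → ℤ → ℝ → ℝ,
        CascadeODESolutionOnShift 𝕊 T ε₀ α K₁ K₂ n₀ X₀ X E →
          ∀ N : ℤ, n₀ ≤ N → ∀ t e : ℤ → ℝ,
            EpochCheckpoints ε₀ θ c i₀ n₀ X₀ P (epochEnvelope env) N X E t e →
              t N + c * (1 + ε₀) ^ (-(5 : ℝ) * N / 2) * (e N)⁻¹ ≤ T →
                ∃ s a : ℝ, EpochCheckpoints ε₀ θ c i₀ n₀ X₀ P (epochEnvelope env) (N + 1) X E
                  (Function.update t (N + 1) s) (Function.update e (N + 1) a) := by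
  intro K₁ K₂ hK₁ hK₂
  obtain ⟨N₀, hN₀⟩ := RestartControlOn.main (𝕊 := 𝕊) (θ := θ) (c := c) (i₀ := i₀) (α := α)
    (X₀ := X₀) (P := P) (env := env) hε hθ hc.le hη hX₀ hK₁ hK₂
  refine ⟨N₀, fun n₀ hn₀ T hT X E hsol N hN t e hcp hhor => ?_⟩
  have heN : 0 < e N := hcp.e_pos N hN le_rfl
  have hq : (0 : ℝ) < 1 + ε₀ := by linarith
  have hpow : 0 < (1 + ε₀) ^ ((5 : ℝ) * N / 2) := Real.rpow_pos_of_pos hq _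
  have hγ : 0 < e N * (1 + ε₀) ^ ((5 : ℝ) * N / 2) := mul_pos heN hpow
  have hneg : (1 + ε₀) ^ (-(5 : ℝ) * N / 2) = ((1 + ε₀) ^ ((5 : ℝ) * N / 2))⁻¹ := by
    rw [← Real.rpow_neg hq.le]
    congr 1
    ring
  have hcγ : c * (1 + ε₀) ^ (-(5 : ℝ) * N / 2) * (e N)⁻¹ =
      c / (e N * (1 + ε₀) ^ ((5 : ℝ) * N / 2)) := by
    rw [hneg]
    field_simp
  rw [hcγ] at hhor
  have hdiv : 0 < c / (e N * (1 + ε₀) ^ ((5 : ℝ) * N / 2)) := div_pos hc hγ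
  have htN : t N < T := by linarith
  have hτ : c ≤ (T - t N) * (e N * (1 + ε₀) ^ ((5 : ℝ) * N / 2)) := by
    have h2 : c / (e N * (1 + ε₀) ^ ((5 : ℝ) * N / 2)) ≤ T - t N := by linarith
    have h3 := mul_le_mul_of_nonneg_right h2 hγ.le
    rwa [div_mul_cancel₀ c hγ.ne'] at h3
  obtain ⟨hflow, hslack⟩ := hN₀ n₀ hn₀ T hT X E hsol N hN t e hcp htN
  obtain ⟨τ₁, a, hst⟩ :=
    hstep (N - n₀).toNat _ _ _ (hcp.state N hN le_rfl) hslack _ hτ _ _ hflow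
  exact ⟨_, _, RestartGlue.epochCheckpoints_succ hε hN hcp hst⟩

/-- **A FIXED-`ε₀` CERTIFICATE GIVES BLOW-UP AT THAT `ε₀` (general admissible shift set).** On a
nearest-neighbour slot-closed shift set `𝕊 ∌ (1,1,1)`, for an `R`-comparable symmetric cancelling table `α`
supported on `𝕊`, `ε₀ > 0` and a charged one-shell datum: format-v2 gap data on `𝕊` with a thin tail imply
`NoGlobalCascadeOn 𝕊 ε₀ α X₀`. Chain: K_B on `𝕊` (`robustStepOn_of_gapData₂On`) ⇒ local checkpoint
induction (`dynamicsLocal_of_robustStepOn`) ⇒ checkpoints at every level contradict the a priori bound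
(4.5) (`LocalDynamicsSufficesAtOn.noGlobalCascadeOn_of_local`), with the base clause = the datum lies in
the reference set `Z`. [cite: Tao2016AveragedNS, §6.1 p. 31 and §6.2 p. 32 (Thm. 4.2 ⇐ Thm. 6.2 ⇐ Props. 6.3–6.5), for a general table] -/
theorem noGlobalCascadeOn_of_gapData₂On (h𝕊 : IsNearestNeighbourSet 𝕊) (h𝕊c : IsSlotClosed 𝕊)
    (h111 : ((1 : ℤ), (1 : ℤ), (1 : ℤ)) ∉ 𝕊) {R σ ε₀ : ℝ} {i₀ : Fin m}
    {α : Fin m → Fin m → Fin m → ℤ × ℤ × ℤ → ℝ} {X₀ : Fin m → ℝ} {Z : Set (Fin m → ℤ → ℝ)}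
    {w : ℤ → ℝ} {r ρ θ₀ θ c₀ c : ℝ} {env₀ : ℤ → ℝ} (hα : InTableClassOn 𝕊 R α) (hε : 0 < ε₀)
    (hX₀ : X₀ i₀ ≠ 0) (hgap : GapData₂On 𝕊 σ ε₀ i₀ α X₀ Z w r ρ θ₀ θ c₀ c env₀)
    (hthin : TailThin ε₀ w r) : NoGlobalCascadeOn 𝕊 ε₀ α X₀ := by
  obtain ⟨η, env, hη, -, hstep⟩ := robustStepOn_of_gapData₂On h𝕊 h𝕊c h111 hα hε hgap hthin
  have hgap1 : GapDataOn 𝕊 ε₀ i₀ α X₀ Z w r ρ θ₀ θ c₀ c env₀ := hgap.1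
  obtain ⟨-, -, -, hθ₀, hθ₀θ, hθ, hc₀, hc₀c, -⟩ := hgap1.signs
  have hball := hgap1.datum_mem_ball (datumEnergy i₀ X₀)
  have hc : 0 < c := lt_trans hc₀ hc₀c
  exact LocalDynamicsSufficesAtOn.noGlobalCascadeOn_of_local (Q := epochEnvelope env) hε
    (by linarith) hc hX₀ hball (dynamicsLocal_of_robustStepOn hε hθ hc hη hX₀ hstep)

/-- The spurious class `(1,1,1)` is not in Tao's `S`. [cite: Tao2016AveragedNS, §4 after (4.1)] -/
theorem one_one_one_not_mem_shiftSet : ((1 : ℤ), (1 : ℤ), (1 : ℤ)) ∉ shiftSet := by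
  intro h
  rcases (mem_shiftSet_iff _).1 h with h | h | h | h <;> simp [Prod.ext_iff] at h

/-- **A FIXED-`ε₀` CERTIFICATE ON `S♭` GIVES BLOW-UP ON `S♭` AT THAT `ε₀`**: for an `R`-comparable table
supported on the two-way nearest-neighbour shift set `S♭`, `ε₀ > 0`, a charged datum, format-v2 gap data on
`S♭` and a thin tail, `NoGlobalCascadeOn shiftSetFlat ε₀ α X₀`. In particular the registered stub
`stub_rung_quarter` of K_A♭ (table `mirrorTable (1/2) (1/2)`, `ε₀ = 1/4`) is, once proved, a blow-up theorem
for that table at scale ratio `5/4`. [cite: Tao2016AveragedNS, §6.1 p. 31 and §6.2 p. 32, for a general table; cell vocabulary (S♭)] -/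
theorem noGlobalCascadeOn_flat_of_gapData₂On {R σ ε₀ : ℝ} {i₀ : Fin m}
    {α : Fin m → Fin m → Fin m → ℤ × ℤ × ℤ → ℝ} {X₀ : Fin m → ℝ} {Z : Set (Fin m → ℤ → ℝ)}
    {w : ℤ → ℝ} {r ρ θ₀ θ c₀ c : ℝ} {env₀ : ℤ → ℝ} (hα : InTableClassOn shiftSetFlat R α) (hε : 0 < ε₀)
    (hX₀ : X₀ i₀ ≠ 0) (hgap : GapData₂On shiftSetFlat σ ε₀ i₀ α X₀ Z w r ρ θ₀ θ c₀ c env₀)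
    (hthin : TailThin ε₀ w r) : NoGlobalCascadeOn shiftSetFlat ε₀ α X₀ :=
  noGlobalCascadeOn_of_gapData₂On isNearestNeighbourSet_shiftSetFlat isSlotClosed_shiftSetFlat
    not_mem_shiftSetFlat_one_one_one hα hε hX₀ hgap hthin

/-- **A FIXED-`ε₀` CERTIFICATE ON TAO'S `S` GIVES BLOW-UP AT THAT `ε₀`** (tree vocabulary): for a table in
`InTableClassOn shiftSet R` (the class `E₂(R)` with support on `S`), `ε₀ > 0`, a charged datum, the tree's
format-v2 gap data `GapData₂` and a thin tail, `NoGlobalCascade ε₀ α X₀` — e.g. a K_A₂(64) certificate at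
`ε₀ = 1` is a blow-up theorem at scale ratio `2` for its table. [cite: Tao2016AveragedNS, §6.1 p. 31 and §6.2 p. 32, for a general table] -/
theorem noGlobalCascade_of_gapData₂ {R σ ε₀ : ℝ} {i₀ : Fin m}
    {α : Fin m → Fin m → Fin m → ℤ × ℤ × ℤ → ℝ} {X₀ : Fin m → ℝ} {Z : Set (Fin m → ℤ → ℝ)}
    {w : ℤ → ℝ} {r ρ θ₀ θ c₀ c : ℝ} {env₀ : ℤ → ℝ} (hα : InTableClassOn shiftSet R α) (hε : 0 < ε₀)
    (hX₀ : X₀ i₀ ≠ 0) (hgap : GapData₂ σ ε₀ i₀ α X₀ Z w r ρ θ₀ θ c₀ c env₀)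
    (hthin : TailThin ε₀ w r) : NoGlobalCascade ε₀ α X₀ :=
  (noGlobalCascadeOn_of_gapData₂On isNearestNeighbourSet_shiftSet isSlotClosed_shiftSet
    one_one_one_not_mem_shiftSet hα hε hX₀ (gapData₂On_shiftSet_iff.2 hgap) hthin).noGlobalCascade

end CertificateGlueOn

end Summit.NavierStokesRegularity.NavierStokesRegularity.Theorems

end
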